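import Summits.QuantumFields.YangMills.Theorems.PoincareLipschitzHierAlignExpToolkit
import HarnessLib

/-!
# Crux stmt-QuantumFields-19936 `HistoryTailL` — S-ALIGN brick L: THE ANALYTIC LETTERS OF THE SHARP STEP
# (guarded logarithm of the potential: size, one-edge difference, change of root; the two link products; convex combinations in `𝔰𝔲`)

Cell `ym3-torus` (rung R3 = YM₃ on T³ — a RUNG, NOT the Clay problem), width seat `ym-ust-19936-w3` gen 12, `--supports stmt-QuantumFields-19936 --as helper`.
Summons w2 g11 02:42:44Z «w3 g12: S-ALIGN».  With `glog g := if ‖g − 1‖ < 1∕3 then log g else 0` (written out), `U' = U·M·g` the transport of the rooted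
potential along one coarse edge (✓`PoincareLipschitzHierAlignPotential.potential_tgt_eq`) and `U_y(z) = U_y(y')·Ũ`, `Ũ ≈ U_{y'}(z)` the change of root,
THIS FILE proves, def-free, for `SU(N)` matrices in the `L²`-operator norm:
* `norm_glog_le_two_mul` — `‖glog g‖ ≤ 2·dist1 g`;  `exp_glog` — `exp (glog g) = g` under the guard;
* ★ `norm_glog_edge_sub_le` — `‖glog(U M g) − glog U‖ ≤ q + 2q² + 4(Y + q)²`, `q = X + 2w` (one coarse edge: first order `X`, NOT `2X`);
* ★ `norm_glog_root_change_le` — `‖glog(U₀ Q D) − glog U₀ − glog D‖ ≤ 2ω + 4(p₀+Y+ω)² + 4(ω+Y)²` (change of root costs `O(w) + O(Y²)`);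
* ★★ `norm_exp_mul_mul_exp_neg_sub_one_le` — INTERIOR LINK `‖e^A F e^{−B} − 1‖ ≤ ‖A − B‖ + 7α² + f`;
* ★★ `norm_exp_mul_mul_exp_mul_exp_sub_one_le` — FACE LINK `‖e^{A₁} F e^{A₂} e^{A₃} − 1‖ ≤ ‖A₁ + A₂ + A₃‖ + 14α² + f`;
* `norm_sum_smul_le_of_weights`, `star_sum_real_smul`, `trace_sum_real_smul`, `norm_exp_le_one_of_skew` (bookkeeping).
-/

noncomputable section

open scoped BigOperators Matrix.Norms.L2Operator
open NormedSpace

namespace Summit.QuantumFields.YangMills.Theorems.PoincareLipschitzHierAlignSharpLemmas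

open Literature.MathematicalPhysics.QuantumFieldTheory.Balaban1983to89
open Literature.MathematicalPhysics.QuantumFieldTheory.Balaban1983to89.MatrixLog (mlog mlog_one exp_mlog norm_mlog_le_two_mul
  norm_mlog_le_div)
open Summit.QuantumFields.YangMills.Theorems.Prop7HolRatioPerStep (coe_star_mul_self coe_mul_star_self norm_coe_eq_one norm_star_coe_eq_one)
open Summit.QuantumFields.YangMills.Theorems.PoincareLipschitzHierAlignExpToolkit

variable {n : Type*} [Fintype n] [DecidableEq n] [Nonempty n]

/-! ## §1 The guarded logarithm -/

/-- `‖glog g‖ ≤ 2·dist1 g`. [folklore] -/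
theorem norm_glog_le_two_mul (g : Matrix.specialUnitaryGroup n ℂ) :
    ‖(if ‖(g : Matrix n n ℂ) - 1‖ < 1 / 3 then mlog (g : Matrix n n ℂ) else 0)‖ ≤ 2 * dist1 g := by
  rw [FederbushMean.dist1_SU_eq]
  split_ifs with h
  · exact norm_mlog_le_two_mul (by linarith)
  · rw [norm_zero]; positivity

/-- Under the guard, `exp (glog g) = g`. [folklore] -/
theorem exp_glog {g : Matrix.specialUnitaryGroup n ℂ} (h : dist1 g < 1 / 3) :
    exp (if ‖(g : Matrix n n ℂ) - 1‖ < 1 / 3 then mlog (g : Matrix n n ℂ) else 0) = (g : Matrix n n ℂ) := by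
  rw [FederbushMean.dist1_SU_eq] at h
  rw [if_pos h]
  exact exp_mlog (by linarith)

omit [Nonempty n] in
/-- `glog 1 = 0`. [folklore] -/
theorem glog_one : (if ‖((1 : Matrix.specialUnitaryGroup n ℂ) : Matrix n n ℂ) - 1‖ < 1 / 3
    then mlog ((1 : Matrix.specialUnitaryGroup n ℂ) : Matrix n n ℂ) else 0) = 0 := by
  have : ((1 : Matrix.specialUnitaryGroup n ℂ) : Matrix n n ℂ) = 1 := rfl
  rw [this, mlog_one]; simp

/-- `‖(Mg) − 1‖ ≤ X + 2w` for `dist1 M ≤ w`, `dist1 g ≤ X ≤ 1`. [folklore] -/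
theorem norm_coe_mul_sub_one_le {M g : Matrix.specialUnitaryGroup n ℂ} {X w : ℝ} (hM : dist1 M ≤ w) (hg : dist1 g ≤ X) (hX1 : X ≤ 1) :
    ‖((M * g : Matrix.specialUnitaryGroup n ℂ) : Matrix n n ℂ) - 1‖ ≤ X + 2 * w := by
  rw [FederbushMean.dist1_SU_eq] at hM hg
  rw [coe_mul]
  have h := norm_mul_sub_one_le_of_le hM hg
  have hw0 : 0 ≤ w := (norm_nonneg _).trans hM
  nlinarith

/-- ★ **ONE COARSE EDGE**: `‖glog(U·M·g) − glog U‖ ≤ q + 2q² + 4(Y + q)²` with `q = X + 2w`, for `dist1 U ≤ Y ≤ 1∕10`, `dist1 M ≤ w`,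
`dist1 g ≤ X`, `X + 2w ≤ 1∕10` — to first order the logarithm of the potential moves by the LINK (`≤ X`), not by `2X`. [folklore] -/
theorem norm_glog_edge_sub_le {U M g : Matrix.specialUnitaryGroup n ℂ} {X w Y : ℝ} (hU : dist1 U ≤ Y) (hY : Y ≤ 1 / 10)
    (hM : dist1 M ≤ w) (hg : dist1 g ≤ X) (hq : X + 2 * w ≤ 1 / 10) (hw0 : 0 ≤ w) :
    ‖(if ‖((U * M * g : Matrix.specialUnitaryGroup n ℂ) : Matrix n n ℂ) - 1‖ < 1 / 3
        then mlog ((U * M * g : Matrix.specialUnitaryGroup n ℂ) : Matrix n n ℂ) else 0) -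
      (if ‖(U : Matrix n n ℂ) - 1‖ < 1 / 3 then mlog (U : Matrix n n ℂ) else 0)‖ ≤
      (X + 2 * w) + 2 * (X + 2 * w) ^ 2 + 4 * (Y + (X + 2 * w)) ^ 2 := by
  have hX1 : X ≤ 1 := by linarith
  have hMg := norm_coe_mul_sub_one_le hM hg hX1
  have hU' : ‖(U : Matrix n n ℂ) - 1‖ ≤ Y := by rwa [FederbushMean.dist1_SU_eq] at hU
  have hq0 : 0 ≤ X + 2 * w := by have := GaugeGroup.dist1_nonneg g; linarith
  -- both guards hold
  have hprod : ((U * M * g : Matrix.specialUnitaryGroup n ℂ) : Matrix n n ℂ) =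
      (U : Matrix n n ℂ) * ((M * g : Matrix.specialUnitaryGroup n ℂ) : Matrix n n ℂ) := by
    rw [mul_assoc]; rfl
  have hg1 : ‖(U : Matrix n n ℂ) - 1‖ < 1 / 3 := by linarith
  have hg2 : ‖((U * M * g : Matrix.specialUnitaryGroup n ℂ) : Matrix n n ℂ) - 1‖ < 1 / 3 := by
    rw [hprod]
    have := norm_mul_sub_one_le_of_le hU' hMg
    nlinarith
  rw [if_pos hg1, if_pos hg2, hprod]
  have hbch := B12Average05And08.norm_mlog_mul_sub_le hU' hMg hY hq
  have hlog : ‖mlog ((M * g : Matrix.specialUnitaryGroup n ℂ) : Matrix n n ℂ)‖ ≤ (X + 2 * w) + 2 * (X + 2 * w) ^ 2 := by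
    have h1 := norm_mlog_le_div (X := ((M * g : Matrix.specialUnitaryGroup n ℂ) : Matrix n n ℂ)) (by linarith)
    set s := ‖((M * g : Matrix.specialUnitaryGroup n ℂ) : Matrix n n ℂ) - 1‖ with hs
    have hs0 : 0 ≤ s := norm_nonneg _
    have hs1 : s ≤ 1 / 10 := hMg.trans hq
    have h2 : s / (1 - s) ≤ s + 2 * s ^ 2 := by
      rw [div_le_iff₀ (by linarith)]; nlinarith
    have h3 : s + 2 * s ^ 2 ≤ (X + 2 * w) + 2 * (X + 2 * w) ^ 2 := by nlinarith
    linarith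
  have e : mlog ((U : Matrix n n ℂ) * ((M * g : Matrix.specialUnitaryGroup n ℂ) : Matrix n n ℂ)) - mlog (U : Matrix n n ℂ) =
      (mlog ((U : Matrix n n ℂ) * ((M * g : Matrix.specialUnitaryGroup n ℂ) : Matrix n n ℂ)) - mlog (U : Matrix n n ℂ) -
        mlog ((M * g : Matrix.specialUnitaryGroup n ℂ) : Matrix n n ℂ)) + mlog ((M * g : Matrix.specialUnitaryGroup n ℂ) : Matrix n n ℂ) := by
    abel
  rw [e]
  exact (norm_add_le _ _).trans (by linarith)

/-- ★ **CHANGE OF ROOT**: for `A = U₀·C`, `C = Q·D` with `dist1 U₀ ≤ p₀`, `dist1 Q ≤ ω`, `dist1 D ≤ Y` (all `≤ 1∕10`, `p₀ + Y + ω ≤ 1∕10`):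
`‖glog A − glog U₀ − glog D‖ ≤ 2ω + 4(p₀ + (ω + Y + ωY))² + 4(ω + Y)²`. [folklore] -/
theorem norm_glog_root_change_le {U₀ Q D : Matrix.specialUnitaryGroup n ℂ} {p₀ ω Y : ℝ} (hU₀ : dist1 U₀ ≤ p₀) (hQ : dist1 Q ≤ ω)
    (hD : dist1 D ≤ Y) (hsum : p₀ + 2 * ω + 2 * Y ≤ 1 / 10) :
    ‖(if ‖((U₀ * (Q * D) : Matrix.specialUnitaryGroup n ℂ) : Matrix n n ℂ) - 1‖ < 1 / 3
        then mlog ((U₀ * (Q * D) : Matrix.specialUnitaryGroup n ℂ) : Matrix n n ℂ) else 0) -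
      (if ‖(U₀ : Matrix n n ℂ) - 1‖ < 1 / 3 then mlog (U₀ : Matrix n n ℂ) else 0) -
      (if ‖(D : Matrix n n ℂ) - 1‖ < 1 / 3 then mlog (D : Matrix n n ℂ) else 0)‖ ≤
      2 * ω + 4 * (p₀ + (ω + Y + ω * Y)) ^ 2 + 4 * (ω + Y) ^ 2 := by
  have h0U := GaugeGroup.dist1_nonneg U₀
  have h0Q := GaugeGroup.dist1_nonneg Q
  have h0D := GaugeGroup.dist1_nonneg D
  rw [FederbushMean.dist1_SU_eq] at hU₀ hQ hD h0U h0Q h0D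
  have hQD : ‖((Q * D : Matrix.specialUnitaryGroup n ℂ) : Matrix n n ℂ) - 1‖ ≤ ω + Y + ω * Y := by
    rw [coe_mul]; exact norm_mul_sub_one_le_of_le hQ hD
  have hωY : ω * Y ≤ ω := by nlinarith
  have hA : ‖((U₀ * (Q * D) : Matrix.specialUnitaryGroup n ℂ) : Matrix n n ℂ) - 1‖ ≤ p₀ + (ω + Y + ω * Y) + p₀ * (ω + Y + ω * Y) := by
    rw [coe_mul]; exact norm_mul_sub_one_le_of_le hU₀ hQD
  have hgA : ‖((U₀ * (Q * D) : Matrix.specialUnitaryGroup n ℂ) : Matrix n n ℂ) - 1‖ < 1 / 3 := by nlinarith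
  have hgU : ‖(U₀ : Matrix n n ℂ) - 1‖ < 1 / 3 := by linarith
  have hgD : ‖(D : Matrix n n ℂ) - 1‖ < 1 / 3 := by linarith
  rw [if_pos hgA, if_pos hgU, if_pos hgD, coe_mul, coe_mul]
  have hQD' : ‖(Q : Matrix n n ℂ) * (D : Matrix n n ℂ) - 1‖ ≤ ω + Y + ω * Y := by rw [← coe_mul]; exact hQD
  have hbch1 := B12Average05And08.norm_mlog_mul_sub_le hU₀ hQD' (by linarith) (by linarith)
  have hbch2 := B12Average05And08.norm_mlog_mul_sub_le hQ hD (by linarith) (by linarith)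
  have hlQ : ‖mlog (Q : Matrix n n ℂ)‖ ≤ 2 * ω := (norm_mlog_le_two_mul (by linarith)).trans (by linarith)
  have e : mlog ((U₀ : Matrix n n ℂ) * ((Q : Matrix n n ℂ) * (D : Matrix n n ℂ))) - mlog (U₀ : Matrix n n ℂ) - mlog (D : Matrix n n ℂ) =
      (mlog ((U₀ : Matrix n n ℂ) * ((Q : Matrix n n ℂ) * (D : Matrix n n ℂ))) - mlog (U₀ : Matrix n n ℂ) -
          mlog ((Q : Matrix n n ℂ) * (D : Matrix n n ℂ))) +
        ((mlog ((Q : Matrix n n ℂ) * (D : Matrix n n ℂ)) - mlog (Q : Matrix n n ℂ) - mlog (D : Matrix n n ℂ)) + mlog (Q : Matrix n n ℂ)) := by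
    abel
  rw [e]
  refine (norm_add_le _ _).trans ?_
  have h2 := norm_add_le (mlog ((Q : Matrix n n ℂ) * (D : Matrix n n ℂ)) - mlog (Q : Matrix n n ℂ) - mlog (D : Matrix n n ℂ))
    (mlog (Q : Matrix n n ℂ))
  linarith

/-! ## §2 The two link products -/

omit [DecidableEq n] [Nonempty n] in
/-- `exp` of a skew-Hermitian matrix is unitary, hence of norm `≤ 1`. [folklore] -/
theorem norm_exp_le_one_of_skew [DecidableEq n] [Nonempty n] {A : Matrix n n ℂ} (hs : star A = -A) : ‖exp A‖ ≤ 1 := by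
  letI : NormedAlgebra ℚ (Matrix n n ℂ) := NormedAlgebra.restrictScalars ℚ ℂ _
  have hmem : exp A ∈ unitary (Matrix n n ℂ) := by
    rw [Unitary.mem_iff]
    constructor
    · rw [star_exp, hs, ← exp_add_of_commute (Commute.refl A).neg_left, neg_add_cancel, exp_zero]
    · rw [star_exp, hs, ← exp_add_of_commute (Commute.refl A).neg_right, add_neg_cancel, exp_zero]
  exact (CStarRing.norm_of_mem_unitary hmem).le

/-- ★★ **THE INTERIOR LINK**: `‖e^A·F·e^{−B} − 1‖ ≤ ‖A − B‖ + 7α² + f` for skew `A, B` of norm `≤ α ≤ 1∕4` and `‖F − 1‖ ≤ f`. [folklore] -/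
theorem norm_exp_mul_mul_exp_neg_sub_one_le {A B F : Matrix n n ℂ} {α f : ℝ} (hA : star A = -A) (hB : star B = -B)
    (hAα : ‖A‖ ≤ α) (hBα : ‖B‖ ≤ α) (hα : α ≤ 1 / 4) (hF : ‖F - 1‖ ≤ f) :
    ‖exp A * F * exp (-B) - 1‖ ≤ ‖A - B‖ + 7 * α ^ 2 + f := by
  have hα0 : 0 ≤ α := (norm_nonneg _).trans hAα
  have hα1 : α ≤ 1 := by linarith
  have hBn : ‖-B‖ ≤ α := by rwa [norm_neg]
  -- remove `F`
  have h1 : ‖exp A * F * exp (-B) - exp A * 1 * exp (-B)‖ ≤ ‖F - 1‖ :=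
    norm_sandwich_sub_le (norm_exp_le_one_of_skew hA) (norm_exp_le_one_of_skew (by rw [star_neg, hB, neg_neg]))
  rw [mul_one] at h1
  -- the two exponentials
  obtain ⟨-, h2⟩ := prod_step (norm_exp_sub_one_le_lin hAα hα1) (norm_exp_sub_one_sub_le_sq hAα hα1)
    (norm_exp_sub_one_le_lin hBn hα1) (norm_exp_sub_one_sub_le_sq hBn hα1)
  have e : exp A * exp (-B) - 1 = (exp A * exp (-B) - 1 - (A + -B)) + (A - B) := by abel
  have h3 : ‖exp A * exp (-B) - 1‖ ≤ ‖A - B‖ + 7 * α ^ 2 := by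
    rw [e]
    refine (norm_add_le _ _).trans ?_
    have hp : α + 2 * α ^ 2 ≤ 3 / 2 * α := by nlinarith
    have hp0 : 0 ≤ α + 2 * α ^ 2 := by positivity
    have hpp : (α + 2 * α ^ 2) * (α + 2 * α ^ 2) ≤ (3 / 2 * α) * (3 / 2 * α) := mul_le_mul hp hp hp0 (by positivity)
    have hsq : (3 / 2 * α) * (3 / 2 * α) = 9 / 4 * α ^ 2 := by ring
    have hα2 := sq_nonneg α
    linarith
  have e2 : exp A * F * exp (-B) - 1 = (exp A * F * exp (-B) - exp A * exp (-B)) + (exp A * exp (-B) - 1) := by abel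
  rw [e2]
  exact (norm_add_le _ _).trans (by linarith)

/-- ★★ **THE FACE LINK**: `‖e^{A₁}·F·e^{A₂}·e^{A₃} − 1‖ ≤ ‖A₁ + A₂ + A₃‖ + 14α² + f` for skew `Aᵢ` of norm `≤ α ≤ 1∕4`,
`‖F − 1‖ ≤ f`. [folklore] -/
theorem norm_exp_mul_mul_exp_mul_exp_sub_one_le {A₁ A₂ A₃ F : Matrix n n ℂ} {α f : ℝ} (h1 : star A₁ = -A₁) (h2 : star A₂ = -A₂)
    (h3 : star A₃ = -A₃) (hA₁ : ‖A₁‖ ≤ α) (hA₂ : ‖A₂‖ ≤ α) (hA₃ : ‖A₃‖ ≤ α) (hα : α ≤ 1 / 4) (hF : ‖F - 1‖ ≤ f) :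
    ‖exp A₁ * F * exp A₂ * exp A₃ - 1‖ ≤ ‖A₁ + A₂ + A₃‖ + 14 * α ^ 2 + f := by
  have hα0 : 0 ≤ α := (norm_nonneg _).trans hA₁
  have hα1 : α ≤ 1 := by linarith
  -- remove `F`: `‖e₁ F (e₂e₃) − e₁ (e₂ e₃)‖ ≤ ‖F − 1‖`
  have h23 : ‖exp A₂ * exp A₃‖ ≤ 1 :=
    (norm_mul_le _ _).trans (by
      have := norm_exp_le_one_of_skew h2; have := norm_exp_le_one_of_skew h3
      nlinarith [norm_nonneg (exp A₂), norm_nonneg (exp A₃)])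
  have hrem : ‖exp A₁ * F * (exp A₂ * exp A₃) - exp A₁ * 1 * (exp A₂ * exp A₃)‖ ≤ ‖F - 1‖ :=
    norm_sandwich_sub_le (norm_exp_le_one_of_skew h1) h23
  rw [mul_one] at hrem
  -- the three exponentials
  obtain ⟨s12, d12⟩ := prod_step (norm_exp_sub_one_le_lin hA₁ hα1) (norm_exp_sub_one_sub_le_sq hA₁ hα1)
    (norm_exp_sub_one_le_lin hA₂ hα1) (norm_exp_sub_one_sub_le_sq hA₂ hα1)
  obtain ⟨-, d123⟩ := prod_step s12 d12 (norm_exp_sub_one_le_lin hA₃ hα1) (norm_exp_sub_one_sub_le_sq hA₃ hα1)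
  have e : exp A₁ * exp A₂ * exp A₃ - 1 = (exp A₁ * exp A₂ * exp A₃ - 1 - (A₁ + A₂ + A₃)) + (A₁ + A₂ + A₃) := by abel
  have hmain : ‖exp A₁ * exp A₂ * exp A₃ - 1‖ ≤ ‖A₁ + A₂ + A₃‖ + 14 * α ^ 2 := by
    rw [e]
    refine (norm_add_le _ _).trans ?_
    set p := α + 2 * α ^ 2 with hp
    have hp1 : p ≤ 3 / 2 * α := by rw [hp]; nlinarith
    have hp0 : 0 ≤ p := by rw [hp]; positivity
    have : (p + p + p * p) * p + (p * p + 2 * α ^ 2 + 2 * α ^ 2) + 2 * α ^ 2 ≤ 14 * α ^ 2 := by nlinarith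
    linarith
  have e2 : exp A₁ * F * exp A₂ * exp A₃ - 1 =
      (exp A₁ * F * (exp A₂ * exp A₃) - exp A₁ * (exp A₂ * exp A₃)) + (exp A₁ * exp A₂ * exp A₃ - 1) := by noncomm_ring
  rw [e2]
  exact (norm_add_le _ _).trans (by linarith)

/-! ## §3 Convex combinations in `𝔰𝔲` -/

omit [DecidableEq n] [Nonempty n] in
/-- A convex combination of vectors of norm `≤ ρ` has norm `≤ ρ`. [folklore] -/
theorem norm_sum_smul_le_of_weights {ι : Type*} (s : Finset ι) {E : Type*} [SeminormedAddCommGroup E] [NormedSpace ℝ E]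
    (W : ι → ℝ) (hW : ∀ i ∈ s, 0 ≤ W i) (hW1 : ∑ i ∈ s, W i = 1) (r : ι → E) {ρ : ℝ} (hr : ∀ i ∈ s, ‖r i‖ ≤ ρ) :
    ‖∑ i ∈ s, W i • r i‖ ≤ ρ := by
  calc ‖∑ i ∈ s, W i • r i‖ ≤ ∑ i ∈ s, ‖W i • r i‖ := norm_sum_le _ _
    _ ≤ ∑ i ∈ s, W i * ρ := Finset.sum_le_sum fun i hi => by
        rw [norm_smul, Real.norm_of_nonneg (hW i hi)]; exact mul_le_mul_of_nonneg_left (hr i hi) (hW i hi)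
    _ = ρ := by rw [← Finset.sum_mul, hW1, one_mul]

omit [Fintype n] [DecidableEq n] [Nonempty n] in
/-- Real combinations of skew-Hermitian matrices are skew-Hermitian. [folklore] -/
theorem star_sum_real_smul {ι : Type*} (s : Finset ι) (c : ι → ℝ) (M : ι → Matrix n n ℂ) (hM : ∀ i ∈ s, star (M i) = -M i) :
    star (∑ i ∈ s, c i • M i) = -∑ i ∈ s, c i • M i := by
  rw [star_sum, ← Finset.sum_neg_distrib]
  refine Finset.sum_congr rfl fun i hi => ?_
  rw [star_smul, hM i hi, star_trivial, smul_neg]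

omit [DecidableEq n] [Nonempty n] in
/-- Real combinations of traceless matrices are traceless. [folklore] -/
theorem trace_sum_real_smul {ι : Type*} (s : Finset ι) (c : ι → ℝ) (M : ι → Matrix n n ℂ) (hM : ∀ i ∈ s, (M i).trace = 0) :
    (∑ i ∈ s, c i • M i).trace = 0 := by
  rw [Matrix.trace_sum]
  exact Finset.sum_eq_zero fun i hi => by rw [Matrix.trace_smul, hM i hi, smul_zero]

omit [Fintype n] [DecidableEq n] [Nonempty n] in
/-- The negative of a skew-Hermitian matrix is skew-Hermitian. [folklore] -/
theorem star_neg_of_skew {A : Matrix n n ℂ} (h : star A = -A) : star (-A) = -(-A) := by rw [star_neg, h]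

end Summit.QuantumFields.YangMills.Theorems.PoincareLipschitzHierAlignSharpLemmas

end
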